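import Summits.HodgeConjecture.HodgeConjecture.Theorems.SecondaryPeriodsHodgeImpliesConiveauOne

/-!
# `LevelOneConiveauThreefolds` (route `SecondaryPeriods`, crux stmt-HodgeConjecture-10376):
# the curve-correspondence line, composed in the tree

The crux is Grothendieck's amended GHC(3,1) for smooth projective threefolds `Y/ℂ`: a rationally
spanned sub-Hodge structure `W = span s ⊆ H³(Y(ℂ); ℂ)` of Hodge coniveau `≥ 1` lies in
`N¹H³(Y) = supportedClasses Y 3 1`. The registered line of the crux
(`Cruxes/LevelOneConiveauThreefolds/Lines/birth.lean`) is Grothendieck's mechanism run forward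
(Topology 8 (1969) p. 301; Abdulali in Kerr–Pearlstein 2016, Ch. 11 Prop. 3.2): STUB 1
(`stub_levelOneSpanOfCurve`) realises `W` as `φ(H¹(C(ℂ); ℂ))` for a smooth projective CURVE `C`
and a rational map `φ` of type `(1,1)` (Riemann's theorem in curve form); STUB 2
(`stub_curveCorrespondenceAlgebraic`, the open heart) makes `φ` the action `γ_*` of an ALGEBRAIC
codimension-2 class `γ` on the fourfold `Y ⊗ C` (the Hodge conjecture for the `(3,1)`-Künneth
classes of codimension 2 on `Y × C`); the action of a class supported in codimension 2 maps `H¹(C)`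
into `N¹H³(Y)` (`range_corrAction_le_supportedClasses`, landed in
`Theorems/SecondaryPeriodsHodgeImpliesConiveauOne`).

This file kernel-checks the composition and the calibrations of the two stubs, with the stub
statements SPELLED OUT as hypotheses (no new definition):

* `span_le_supportedClasses_of_corrAction_eq` — pointwise glue: `W = im φ`, `φ = γ_*`, `γ`
  algebraic of codimension 2 on `Y ⊗ C` ⟹ `W ⊆ N¹H³(Y)`;
* `span_le_supportedClasses_of_curveRealisation` — GHC(3,1) for ONE pair `(Y, W)` from a curve
  realisation of `W` and the algebraicity of the level-one curve correspondences into `H³(Y)`;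
* `levelOneConiveauThreefolds_of_curveCorrespondences` — STUB 1 ∧ STUB 2 ⟹ the crux, by name;
* `levelOneSpanOfCurve_of_weightOne_curve` — STUB 1 from the named fact
  `weightOne_polarizable_eq_range_of_curve` (Riemann, curve form) through the landed reduction
  `exists_curve_of_levelOne_threefold_span` and the landed Hodge–Riemann polarisability;
* `curveCorrespondenceAlgebraic_of_hodgeConjectureFor` / `…_of_hodgeConjecture` — STUB 2 at
  `(Y, C)` from the codimension-2 clause of the Hodge conjecture for the fourfold `Y ⊗ C` (Voisin I
  Lemma 11.41, the tree's unconditional `exists_rational_hodgeClass_corrAction_eq_smul`);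
* `levelOneConiveauThreefolds_of_weightOne_curve_of_curveCorrespondences` — the crux modulo
  {Riemann's theorem in curve form, STUB 2}.

The rank-two case (the attractor-plane regime `dim W = 2`, where Riemann's theorem is the landed
`weightOne_polarizable_eq_range_of_curve_of_finrank_eq_two`) is the sequel file
`…CurveCorrespondencesRankTwo`.
-/

noncomputable section

-- `Summit.HodgeConjecture.HodgeConjecture.Theorems` is the mandated namespace (single-conjunct summit:
-- Sub = Summit), which `linter.dupNamespace` flags on every declaration; the lakefile turns the
-- linter off tree-wide (weak option), restated here so stand-alone elaboration is warning-free too.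
set_option linter.dupNamespace false

open scoped Manifold
open CategoryTheory AlgebraicGeometry MonoidalCategory CartesianMonoidalCategory
open Literature.AlgebraicTopology.SingularHomology
open Literature.AlgebraicGeometry Literature.AlgebraicGeometry.Motives
open Literature.AlgebraicGeometry.HodgeTheory

namespace Summit.HodgeConjecture.HodgeConjecture.Theorems

/-! ### Pointwise glue -/

/-- **Pointwise glue of the line.** If `W = im φ` for `φ : H¹(C(ℂ)) → H³(Y(ℂ))` and `φ = γ_*` for a
class `γ` on the fourfold `Y ⊗ C` supported in codimension `2` (`algebraicClasses (Y ⊗ C) 2`), then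
`W ⊆ N¹H³(Y)`: the action of a class supported in codimension `r` from a source of dimension `n`
lands in `N^{r-n}` (`range_corrAction_le_supportedClasses`, `1 + 1 ≤ 2`).
[cite: GrothendieckTopology1969, p. 301] -/
theorem span_le_supportedClasses_of_corrAction_eq (μ : OrientationFamily) {Y C : SchemeOver ℂ}
    (hY : IsSmoothProjective 3 Y) (hC : IsSmoothProjective 1 C) {W : Submodule ℂ (complexBetti Y 3)}
    {φ : complexBetti C 1 →ₗ[ℂ] complexBetti Y 3} (hrange : LinearMap.range φ = W)
    {γ : complexBetti (Y ⊗ C) (2 * 2)} (hγ : γ ∈ algebraicClasses (Y ⊗ C) 2)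
    (hγφ : corrAction μ hY hC (show 1 + 2 * 2 = 3 + 2 * 1 from rfl) γ = φ) :
    W ≤ supportedClasses Y 3 1 := by
  rw [← hrange, ← hγφ]
  exact range_corrAction_le_supportedClasses μ hY hC _ (show 1 + 1 ≤ 2 by norm_num) hγ

/-- **GHC(3,1) for one pair `(Y, W)` from the two inputs of the line at `Y`.** If `W = span s` is
the image of `H¹(C(ℂ))` of a smooth projective curve `C` under a rational map `φ` of type `(1,1)`
(a curve realisation), and every rational type-`(1,1)` map `H¹(C'(ℂ)) → H³(Y(ℂ))` from a smooth
projective curve `C'` into THIS `Y` is the action of an algebraic codimension-2 class on `Y ⊗ C'`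
(for the orientation family `μ`), then `W ⊆ N¹H³(Y)`. [cite: GrothendieckTopology1969, p. 301]
[cite: KerrPearlstein2016, Ch. 11 (Abdulali) Prop. 3.2 p. 291] -/
theorem span_le_supportedClasses_of_curveRealisation (μ : OrientationFamily) {Y : SchemeOver ℂ}
    (hY : IsSmoothProjective 3 Y) (A : HodgeModel 3 Y) (W : Submodule ℂ (complexBetti Y 3))
    (h1 : ∃ (C : SchemeOver ℂ) (_ : IsSmoothProjective 1 C) (B : HodgeModel 1 C)
      (φ : complexBetti C 1 →ₗ[ℂ] complexBetti Y 3),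
      (∀ c, IsRationalClass c → IsRationalClass (φ c)) ∧
      (∀ (p q : ℕ), p + q = 1 → ∀ c, B.pullback 1 c ∈ B.hodgePQ 1 p q →
        A.pullback 3 (φ c) ∈ A.hodgePQ 3 (p + 1) (q + 1)) ∧
      LinearMap.range φ = W)
    (h2 : ∀ ⦃C : SchemeOver ℂ⦄ (hC : IsSmoothProjective 1 C) (B : HodgeModel 1 C)
      (φ : complexBetti C 1 →ₗ[ℂ] complexBetti Y 3),
      (∀ c, IsRationalClass c → IsRationalClass (φ c)) →
      (∀ (p q : ℕ), p + q = 1 → ∀ c, B.pullback 1 c ∈ B.hodgePQ 1 p q →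
        A.pullback 3 (φ c) ∈ A.hodgePQ 3 (p + 1) (q + 1)) →
      ∃ γ ∈ algebraicClasses (Y ⊗ C) 2,
        corrAction μ hY hC (show 1 + 2 * 2 = 3 + 2 * 1 from rfl) γ = φ) :
    W ≤ supportedClasses Y 3 1 := by
  obtain ⟨C, hC, B, φ, hφ, hφH, hrange⟩ := h1
  obtain ⟨γ, hγ, hγφ⟩ := h2 hC B φ hφ hφH
  exact span_le_supportedClasses_of_corrAction_eq μ hY hC hrange hγ hγφ

/-! ### The composition: STUB 1 ∧ STUB 2 ⟹ the crux, by name -/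

/-- **`LevelOneConiveauThreefolds` from the two registered stubs of the line** (statements spelled
out): STUB 1 — every rationally spanned level-one sub-Hodge structure `span s` of `H³` of a smooth
projective threefold is `φ(H¹(C(ℂ)))` for a smooth projective curve `C` and a rational type-`(1,1)`
map `φ` (Riemann's theorem, curve form); STUB 2 — every such `φ` is `γ_*` for an algebraic
codimension-2 class `γ` on `Y ⊗ C` (the Hodge conjecture for the `(3,1)`-Künneth classes of
codimension 2 on the fourfold `Y × C`). An orientation family exists (complex points of smooth
projective varieties are orientable), and `span_le_supportedClasses_of_curveRealisation` concludes.
[cite: GrothendieckTopology1969, p. 301] [cite: KerrPearlstein2016, Ch. 11 (Abdulali) Prop. 3.2 p. 291] -/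
theorem levelOneConiveauThreefolds_of_curveCorrespondences
    (h1 : ∀ ⦃Y : SchemeOver ℂ⦄, IsSmoothProjective 3 Y → ∀ (A : HodgeModel 3 Y)
      (s : Finset (complexBetti Y 3)), (∀ c ∈ s, IsRationalClass c) →
      (Submodule.span ℂ (↑s : Set (complexBetti Y 3))).map (A.pullback 3).hom =
        (⨆ (p : ℕ) (q : ℕ) (_ : p + q = 3),
          (Submodule.span ℂ (↑s : Set (complexBetti Y 3))).map (A.pullback 3).hom ⊓
            A.hodgePQ 3 p q) →
      (Submodule.span ℂ (↑s : Set (complexBetti Y 3))).map (A.pullback 3).hom ≤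
        (⨆ (p : ℕ) (q : ℕ) (_ : p + q = 3) (_ : 1 ≤ p) (_ : 1 ≤ q), A.hodgePQ 3 p q) →
      ∃ (C : SchemeOver ℂ) (_ : IsSmoothProjective 1 C) (B : HodgeModel 1 C)
        (φ : complexBetti C 1 →ₗ[ℂ] complexBetti Y 3),
        (∀ c, IsRationalClass c → IsRationalClass (φ c)) ∧
        (∀ (p q : ℕ), p + q = 1 → ∀ c, B.pullback 1 c ∈ B.hodgePQ 1 p q →
          A.pullback 3 (φ c) ∈ A.hodgePQ 3 (p + 1) (q + 1)) ∧
        LinearMap.range φ = Submodule.span ℂ (↑s : Set (complexBetti Y 3)))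
    (h2 : ∀ ⦃Y C : SchemeOver ℂ⦄ (hY : IsSmoothProjective 3 Y) (hC : IsSmoothProjective 1 C)
      (A : HodgeModel 3 Y) (B : HodgeModel 1 C) (φ : complexBetti C 1 →ₗ[ℂ] complexBetti Y 3),
      (∀ c, IsRationalClass c → IsRationalClass (φ c)) →
      (∀ (p q : ℕ), p + q = 1 → ∀ c, B.pullback 1 c ∈ B.hodgePQ 1 p q →
        A.pullback 3 (φ c) ∈ A.hodgePQ 3 (p + 1) (q + 1)) →
      ∀ (μ : OrientationFamily), ∃ γ ∈ algebraicClasses (Y ⊗ C) 2,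
        corrAction μ hY hC (show 1 + 2 * 2 = 3 + 2 * 1 from rfl) γ = φ) :
    Theses.SecondaryPeriods.LevelOneConiveauThreefolds := by
  intro Y hY A s hs hsub hlev
  obtain ⟨μ⟩ : Nonempty OrientationFamily :=
    ⟨fun _ _ h ↦ Classical.choice (ComplexPoints.isOrientableOver ℂ h)⟩
  exact span_le_supportedClasses_of_curveRealisation μ hY A _ (h1 hY A s hs hsub hlev)
    fun C hC B φ hφ hφH ↦ h2 hY hC A B φ hφ hφH μ

/-! ### Calibration of STUB 1: Riemann's theorem in curve form -/

/-- **STUB 1 from Riemann's theorem (curve form).** The registered statement of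
`stub_levelOneSpanOfCurve` follows from the named fact `weightOne_polarizable_eq_range_of_curve`
(a polarisable effective weight-one `ℚ`-Hodge structure is a Hodge quotient of `H¹` of a smooth
projective curve: Riemann's theorem, abelian varieties as quotients of Jacobians, Voisin I
Lemma 7.26) by the landed reduction `exists_curve_of_levelOne_threefold_span` fed with the landed
Hodge–Riemann polarisability `smoothProjective_hodgeStructure_isPolarizable_holds`. So STUB 1 is
closed modulo that one named fact. [cite: KerrPearlstein2016, Ch. 11 (Abdulali) §1 p. 288]
[cite: VoisinHodgeI2002, §7.2.2 and §7.3.1 Lemma 7.26] [cite: LangeBirkenhake1992, Prop. 4.5.8] -/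
theorem levelOneSpanOfCurve_of_weightOne_curve (h0 : weightOne_polarizable_eq_range_of_curve)
    ⦃Y : SchemeOver ℂ⦄ (hY : IsSmoothProjective 3 Y) (A : HodgeModel 3 Y)
    (s : Finset (complexBetti Y 3)) (hs : ∀ c ∈ s, IsRationalClass c)
    (hsub : (Submodule.span ℂ (↑s : Set (complexBetti Y 3))).map (A.pullback 3).hom =
      ⨆ (p : ℕ) (q : ℕ) (_ : p + q = 3),
        (Submodule.span ℂ (↑s : Set (complexBetti Y 3))).map (A.pullback 3).hom ⊓ A.hodgePQ 3 p q)
    (hlev : (Submodule.span ℂ (↑s : Set (complexBetti Y 3))).map (A.pullback 3).hom ≤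
      ⨆ (p : ℕ) (q : ℕ) (_ : p + q = 3) (_ : 1 ≤ p) (_ : 1 ≤ q), A.hodgePQ 3 p q) :
    ∃ (C : SchemeOver ℂ) (_ : IsSmoothProjective 1 C) (B : HodgeModel 1 C)
      (φ : complexBetti C 1 →ₗ[ℂ] complexBetti Y 3),
      (∀ c, IsRationalClass c → IsRationalClass (φ c)) ∧
      (∀ (p q : ℕ), p + q = 1 → ∀ c, B.pullback 1 c ∈ B.hodgePQ 1 p q →
        A.pullback 3 (φ c) ∈ A.hodgePQ 3 (p + 1) (q + 1)) ∧
      LinearMap.range φ = Submodule.span ℂ (↑s : Set (complexBetti Y 3)) :=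
  exists_curve_of_levelOne_threefold_span h0 smoothProjective_hodgeStructure_isPolarizable_holds
    hY A s hs hsub hlev

/-! ### Calibration of STUB 2: the Hodge conjecture in codimension 2 on `Y ⊗ C` -/

/-- **STUB 2 at `(Y, C)` from the codimension-2 clause of the Hodge conjecture for the fourfold
`Y ⊗ C`.** A rational type-`(1,1)` map `φ : H¹(C(ℂ)) → H³(Y(ℂ))` is `t⁻¹ • γ_*` for a RATIONAL
class `γ ∈ H⁴((Y ⊗ C)(ℂ); ℂ)` of Hodge type `(2,2)` and `t ≠ 0` (Voisin I Lemma 11.41 on the tree's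
carriers, the unconditional `exists_rational_hodgeClass_corrAction_eq_smul`); if rational
`(2,2)`-classes on `Y ⊗ C` are algebraic, `t⁻¹ • γ` is the required algebraic class.
[cite: VoisinHodgeI2002, §11.3.3 Lemma 11.41] [cite: GrothendieckTopology1969, p. 301] -/
theorem curveCorrespondenceAlgebraic_of_hodgeConjectureFor {Y C : SchemeOver ℂ}
    (hY : IsSmoothProjective 3 Y) (hC : IsSmoothProjective 1 C)
    (hHC : ∀ γ : complexBetti (Y ⊗ C) (2 * 2), IsRationalClass γ →
      IsOfHodgeType (3 + 1) (Y ⊗ C) (2 * 2) 2 2 γ → γ ∈ algebraicClasses (Y ⊗ C) 2)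
    (A : HodgeModel 3 Y) (B : HodgeModel 1 C) (φ : complexBetti C 1 →ₗ[ℂ] complexBetti Y 3)
    (hφ : ∀ c, IsRationalClass c → IsRationalClass (φ c))
    (hφH : ∀ (p q : ℕ), p + q = 1 → ∀ c, B.pullback 1 c ∈ B.hodgePQ 1 p q →
      A.pullback 3 (φ c) ∈ A.hodgePQ 3 (p + 1) (q + 1))
    (μ : OrientationFamily) :
    ∃ γ ∈ algebraicClasses (Y ⊗ C) 2,
      corrAction μ hY hC (show 1 + 2 * 2 = 3 + 2 * 1 from rfl) γ = φ := by
  obtain ⟨γ, hγ, hγH, t, ht, heq⟩ :=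
    exists_rational_hodgeClass_corrAction_eq_smul hY hC A B (show 1 + 2 * 2 = 3 + 2 * 1 from rfl)
      (show 1 + 1 = 2 from rfl) φ hφ hφH μ
  refine ⟨t⁻¹ • γ, Submodule.smul_mem _ _ (hHC γ hγ hγH), ?_⟩
  rw [map_smul, heq, smul_smul, inv_mul_cancel₀ ht, one_smul]

/-- **STUB 2 from the Hodge conjecture** (the registered statement of
`stub_curveCorrespondenceAlgebraic` is a special case of the summit: HC for the fourfolds `Y ⊗ C`
in codimension 2). [cite: VoisinHodgeI2002, §11.3.3 Lemma 11.41] [cite: GrothendieckTopology1969, p. 301] -/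
theorem curveCorrespondenceAlgebraic_of_hodgeConjecture (hHC : _root_.HodgeConjecture)
    ⦃Y C : SchemeOver ℂ⦄ (hY : IsSmoothProjective 3 Y) (hC : IsSmoothProjective 1 C)
    (A : HodgeModel 3 Y) (B : HodgeModel 1 C) (φ : complexBetti C 1 →ₗ[ℂ] complexBetti Y 3)
    (hφ : ∀ c, IsRationalClass c → IsRationalClass (φ c))
    (hφH : ∀ (p q : ℕ), p + q = 1 → ∀ c, B.pullback 1 c ∈ B.hodgePQ 1 p q →
      A.pullback 3 (φ c) ∈ A.hodgePQ 3 (p + 1) (q + 1))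
    (μ : OrientationFamily) :
    ∃ γ ∈ algebraicClasses (Y ⊗ C) 2,
      corrAction μ hY hC (show 1 + 2 * 2 = 3 + 2 * 1 from rfl) γ = φ :=
  curveCorrespondenceAlgebraic_of_hodgeConjectureFor hY hC
    (fun γ hγ hγH ↦ (hHC (IsSmoothProjective.tensor_holds hY hC)).2 2 γ hγ hγH) A B φ hφ hφH μ

/-! ### The crux modulo {Riemann's theorem in curve form, STUB 2} -/

/-- **`LevelOneConiveauThreefolds` from Riemann's theorem (curve form) and STUB 2.** With STUB 1
calibrated (`levelOneSpanOfCurve_of_weightOne_curve`), the crux is the conjunction of ONE named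
fact of the literature (`weightOne_polarizable_eq_range_of_curve`) and ONE open statement (the
algebraicity of level-one curve correspondences into `H³` of threefolds = HC for the
`(3,1)`-Künneth codimension-2 classes on the fourfolds `Y × C`).
[cite: GrothendieckTopology1969, p. 301] [cite: KerrPearlstein2016, Ch. 11 (Abdulali) Prop. 3.2 p. 291] -/
theorem levelOneConiveauThreefolds_of_weightOne_curve_of_curveCorrespondences
    (h0 : weightOne_polarizable_eq_range_of_curve)
    (h2 : ∀ ⦃Y C : SchemeOver ℂ⦄ (hY : IsSmoothProjective 3 Y) (hC : IsSmoothProjective 1 C)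
      (A : HodgeModel 3 Y) (B : HodgeModel 1 C) (φ : complexBetti C 1 →ₗ[ℂ] complexBetti Y 3),
      (∀ c, IsRationalClass c → IsRationalClass (φ c)) →
      (∀ (p q : ℕ), p + q = 1 → ∀ c, B.pullback 1 c ∈ B.hodgePQ 1 p q →
        A.pullback 3 (φ c) ∈ A.hodgePQ 3 (p + 1) (q + 1)) →
      ∀ (μ : OrientationFamily), ∃ γ ∈ algebraicClasses (Y ⊗ C) 2,
        corrAction μ hY hC (show 1 + 2 * 2 = 3 + 2 * 1 from rfl) γ = φ) :
    Theses.SecondaryPeriods.LevelOneConiveauThreefolds :=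
  levelOneConiveauThreefolds_of_curveCorrespondences (levelOneSpanOfCurve_of_weightOne_curve h0) h2

/-- **GHC(3,1) for ONE threefold `Y` from Riemann's theorem (curve form) and the Hodge conjecture in
codimension 2 on the fourfolds `Y ⊗ C`, `C` ranging over smooth projective curves** — the pointwise
form of Grothendieck's observation with the summit replaced by exactly the instances it uses.
[cite: GrothendieckTopology1969, p. 301] [cite: KerrPearlstein2016, Ch. 11 (Abdulali) Prop. 3.2 p. 291] -/
theorem span_le_supportedClasses_of_weightOne_curve_of_hodgeConjectureFor
    (h0 : weightOne_polarizable_eq_range_of_curve) {Y : SchemeOver ℂ} (hY : IsSmoothProjective 3 Y)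
    (hHC : ∀ ⦃C : SchemeOver ℂ⦄, IsSmoothProjective 1 C → ∀ γ : complexBetti (Y ⊗ C) (2 * 2),
      IsRationalClass γ → IsOfHodgeType (3 + 1) (Y ⊗ C) (2 * 2) 2 2 γ → γ ∈ algebraicClasses (Y ⊗ C) 2)
    (A : HodgeModel 3 Y) (s : Finset (complexBetti Y 3)) (hs : ∀ c ∈ s, IsRationalClass c)
    (hsub : (Submodule.span ℂ (↑s : Set (complexBetti Y 3))).map (A.pullback 3).hom =
      ⨆ (p : ℕ) (q : ℕ) (_ : p + q = 3),
        (Submodule.span ℂ (↑s : Set (complexBetti Y 3))).map (A.pullback 3).hom ⊓ A.hodgePQ 3 p q)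
    (hlev : (Submodule.span ℂ (↑s : Set (complexBetti Y 3))).map (A.pullback 3).hom ≤
      ⨆ (p : ℕ) (q : ℕ) (_ : p + q = 3) (_ : 1 ≤ p) (_ : 1 ≤ q), A.hodgePQ 3 p q) :
    Submodule.span ℂ (↑s : Set (complexBetti Y 3)) ≤ supportedClasses Y 3 1 := by
  obtain ⟨μ⟩ : Nonempty OrientationFamily :=
    ⟨fun _ _ h ↦ Classical.choice (ComplexPoints.isOrientableOver ℂ h)⟩
  exact span_le_supportedClasses_of_curveRealisation μ hY A _
    (levelOneSpanOfCurve_of_weightOne_curve h0 hY A s hs hsub hlev)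
    fun C hC B φ hφ hφH ↦ curveCorrespondenceAlgebraic_of_hodgeConjectureFor hY hC (hHC hC) A B φ hφ hφH μ

/-! ### Registered sub-goal of the crux (line `registered`): the composition, in pure-signature form -/

/-- **Registered sub-goal `stub_composition_levelOneConiveauThreefolds` of crux stmt-HodgeConjecture-10376**
(line `registered`): STUB 1 → STUB 2 → `LevelOneConiveauThreefolds`, the composition of the line in the
verbatim binder shape of the two registered stubs (proved by `levelOneConiveauThreefolds_of_curveCorrespondences`).
[cite: GrothendieckTopology1969, p. 301] [cite: KerrPearlstein2016, Ch. 11 (Abdulali) Prop. 3.2 p. 291] -/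
theorem stub_composition_levelOneConiveauThreefolds : (∀ ⦃Y : Motives.SchemeOver ℂ⦄, Motives.IsSmoothProjective 3 Y → ∀ (A : HodgeModel 3 Y) (s : Finset (complexBetti Y 3)), (∀ c ∈ s, IsRationalClass c) → (Submodule.span ℂ (↑s : Set (complexBetti Y 3))).map (A.pullback 3).hom = (⨆ (p : ℕ) (q : ℕ) (_ : p + q = 3), (Submodule.span ℂ (↑s : Set (complexBetti Y 3))).map (A.pullback 3).hom ⊓ A.hodgePQ 3 p q) → (Submodule.span ℂ (↑s : Set (complexBetti Y 3))).map (A.pullback 3).hom ≤ (⨆ (p : ℕ) (q : ℕ) (_ : p + q = 3) (_ : 1 ≤ p) (_ : 1 ≤ q), A.hodgePQ 3 p q) → ∃ (C : Motives.SchemeOver ℂ) (_ : Motives.IsSmoothProjective 1 C) (B : HodgeModel 1 C) (φ : complexBetti C 1 →ₗ[ℂ] complexBetti Y 3), (∀ c, IsRationalClass c → IsRationalClass (φ c)) ∧ (∀ (p q : ℕ), p + q = 1 → ∀ c, B.pullback 1 c ∈ B.hodgePQ 1 p q → A.pullback 3 (φ c) ∈ A.hodgePQ 3 (p + 1) (q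 + 1)) ∧ LinearMap.range φ = Submodule.span ℂ (↑s : Set (complexBetti Y 3))) → (∀ ⦃Y C : Motives.SchemeOver ℂ⦄ (hY : Motives.IsSmoothProjective 3 Y) (hC : Motives.IsSmoothProjective 1 C) (A : HodgeModel 3 Y) (B : HodgeModel 1 C) (φ : complexBetti C 1 →ₗ[ℂ] complexBetti Y 3), (∀ c, IsRationalClass c → IsRationalClass (φ c)) → (∀ (p q : ℕ), p + q = 1 → ∀ c, B.pullback 1 c ∈ B.hodgePQ 1 p q → A.pullback 3 (φ c) ∈ A.hodgePQ 3 (p + 1) (q + 1)) → ∀ (μ : OrientationFamily), ∃ γ ∈ algebraicClasses (Y ⊗ C) 2, corrAction μ hY hC (show 1 + 2 * 2 = 3 + 2 * 1 from rfl) γ = φ) → Summit.HodgeConjecture.HodgeConjecture.Theses.SecondaryPeriods.LevelOneConiveauThreefolds :=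
  fun h1 h2 ↦ levelOneConiveauThreefolds_of_curveCorrespondences h1 h2

end Summit.HodgeConjecture.HodgeConjecture.Theorems

end
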